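import Summits.QuantumFields.BalabanUV.T4Continuum.Support.NE9FadingArithmetic
import Summits.QuantumFields.BalabanUV.T4Continuum.Support.NE9Lemma1Gain

/-!
# NE9FadingArithmeticHolder — leaf N2 of the NE9 skeleton AT THE AMENDED RATE LETTER `ω = L^{−β}`, β the (DECLARED, positive)
# Hölder exponent of [I] (4.18): crew item (w6) «certified fading arithmetic» AMENDED per the row owner's located finding
# F-ne9p1g23-1 / GAPS O-ne9p1g23-1 and OWNER RULING (journal l.7710 (E)), referee pass 4 DV-10 (cell `pub-balaban`, T⁴ programme,
# row NE9; NE9 formalisation swarm, unit `b2b-balaban-t4-ne9-formalise-leaf-10`, gen 3; sibling of `NE9FadingArithmetic` (FULL))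

HONEST FRAMING (T4-DAG PAGE 1).  Rung (B)+1 = existence and uniqueness of the ε → 0 limit of gauge-invariant expectations on a
FIXED finite torus T⁴ — NOT infinite volume, NOT a mass gap, NOT the Clay problem.  NE9 is NOT PRINTED and NOT PROVED; N2 stays a
DISPLAYED binder (trigger c3) — the inequality `μ < 1` is OURS (GAPS G-ne9p2-3), decided here as real arithmetic among abstract
letters; the [I]/[II] locators say only which printed sentence a HYPOTHESIS SHAPE types (ABSOLUTE RULE).  0 `def`, 0 sorry.
HONEST DEPENDENCY (verbatim): continuum YM on T⁴ ⇐ BetaPertH ∧ nine spine estimates (0/9 proved); BetaPertH ⇐ (D1) ∧ (D4) ∧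
CAP+tail; G-an2-4 gates asym, D1 and NE2/3/4.

WHY (owner's located finding, renders re-read by t4-ne9-p1-g23 and countersigned by the swarm referee).  The per-creation-step
fading factor of the history channel is the gain of the localized curly bracket on marginal-free inputs; its exponent is the `α`
of [I] (0.29)–(0.30) p. 258 («Σ_{j=1}^k O(1)(L^jη)^α … ≦ O(1)(1 − L^{−α})⁻¹»), and for the (4.30)-species `α = β < 1`, the Hölder
exponent of (4.18) p. 285 «|(∂_λ∂_νB_μ)(x)| < α₁(L^jη)^{2+β}, 0 ≦ β ≦ β₀ < 1», p. 288 «with a positive β … the power 4 + β instead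
of 5 … Hence this is an irrelevant term»; [II] p. 8's «(6L)⁴L^jη … 2(6L)⁴» is the displayed fifth-order species only.  So the END's
rate letter is **`ω := L^{−β}`, NOT `L⁻¹`**; every END face is parametric in `ω` (nothing structural moves), but (w6)'s printed-letter
threshold `fade_of_printed` (`1/L + K·lipbar·B·τ̄ < 1 ⇐ 648·K·c₁c₂ < (1 − 1/L)·M⁴`) and its census numerals are the instance β = 1.
THIS FILE restates them at `ω = L^{−β}` with β DECLARED.

WHAT IS PROVED (kernel; Mathlib real arithmetic + the two imports BY NAME).
§1 THE LETTER: `rate_pos_lt_one` (`0 < L^{−β} < 1` for `1 < L`, `0 < β` — owner's `NE9Lemma1Gain.rpow_neg_pos_lt_one`),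
   `rate_antitone` / `gap_mono` (the gap `1 − L^{−β}` is INCREASING in β: the binding case of a declared range `β₁ ≤ β ≤ β₀` is its
   LOWER end), `rate_at_one` (`β = 1`: the former `1/L`), `rate_at_zero` (`β = 0`: the letter is `1`), `one_sub_rate_le`
   (`1 − L^{−β} ≤ β·log L`: the gap closes linearly as β ↓ 0).
§2 THE THRESHOLD: `gap_threshold_iff_rate` (`ω + X/M⁴ < 1 ↔ X < (1 − ω)·M⁴`); **`fade_of_printed_rate` / `fade_of_printed_rpow`** —
   under the located standing assumptions of [II] typed as hypotheses (`(LM)⁴α₄ ≤ 1` p. 20, `B ≤ E₀/2` p. 21; (w6)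
   `rateGap_le_of_printed` BY NAME: `E₀` cancels, no `ε₁`) and the ONE clause `648·K·c₁c₂ < (1 − L^{−β})·M⁴`, the rate
   `L^{−β} + K·lipbar·B·τ̄` is `< 1`; `fade_of_printed_rpow_of_le` — UNIFORM on a declared range `β₁ ≤ β` (the room at β₁ suffices);
   `fade_of_printed_rpow_one` — (w6)'s `fade_of_printed` IS the instance β = 1; **`not_fade_at_exponent_zero`** — at β = 0 (admitted
   by (4.18)'s «0 ≦ β») no nonnegative gap fades: N2 at the amended letter needs p. 288's «positive β» STRICTLY; `room_le` /
   **`room_not_uniform`** — the clause forces `648·K·c₁c₂ < β·log L·M⁴`, so for every budget there is a positive β violating it: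
   «M sufficiently large» is `M = M(β)`, NOT uniform in β ∈ ]0, β₀].  All lemmas are parametric in `K ≥ 0`, so the (w10) rider
   `K_eff = K·(1 + cr·a)` (`NE9FadingArithmeticRider.rate_marg_eq`) is an instance (`example`).
§3 THE j-SUMMED COMPANION of `τ̄`: `Σ_{j≤k} c_Q·(L^{−β})^{k−j} ≤ c_Q·(1 − L^{−β})⁻¹` (owner's `sum_tauOfG_le` at `ω := L^{−β}`,
   TYPE (0.30)) and its monotonicity on a declared range (`companion_le_of_le`).
§4 NUMERIC CORNERS (`norm_num` + bracketing of `13^{−1/4}` by integer fourth powers; NO letter of Bałaban's is valued):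
   `rpow13_neg_quarter_bounds` (`10/19 < 13^{−1/4} < 100/189`), hence at the least printed side length `L = 13`, `M = L`, `K = 4`,
   `β = 1/4` the room of `fade_of_printed_rpow` is `c₁c₂ ≤ 2541929/489888 ≈ 5.19` sufficient (`room_quarter_suff`) while
   `c₁c₂ ≥ 257049/49248 ≈ 5.22` violates the clause (`room_quarter_nec`) — versus (w6)'s `6591/648 ≈ 10.17` at β = 1: the room
   roughly HALVES at β = 1/4 (and halves again at K = 8).  Census sheet v1.3 §9 with the two-engine table:
   `HOME/t4/b2b-balaban-t4-ne9-formalise-leaf-10/NE9FadingCensus.md`.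

References (TYPES only): [Balaban1987RG1] T. Bałaban, CMP 109 (1987) (0.29)–(0.30) p. 258, (4.18) p. 285, p. 288, p. 251, Thm 3
p. 264; [Balaban1988RG2Cluster] CMP 116 (1988) p. 8, (1.36) p. 9, (2.18)–(2.20) p. 16, p. 20, (2.41) p. 21.
-/

namespace Summit.QuantumFields.BalabanUV.T4Continuum.NE9FadingArithmeticHolder

open scoped BigOperators
open Summit.QuantumFields.BalabanUV.T4Continuum.NE9FadingArithmetic
open Summit.QuantumFields.BalabanUV.T4Continuum.NE9Lemma1Gain

/-! ## §1 The rate letter `ω = L^{−β}` -/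

section Letter

/-- **THE LETTER**: `0 < L^{−β} < 1` for `1 < L` and a POSITIVE exponent `β` — the owner's `NE9Lemma1Gain.rpow_neg_pos_lt_one` BY
NAME (TYPE: the ratio of [I] (0.30); for the (4.30)-species `β` is the Hölder exponent of (4.18), p. 288 «with a positive β»).
[cite: Balaban1987RG1, (0.30) p.258, (4.18) p.285, p.288] -/
theorem rate_pos_lt_one {L β : ℝ} (hL : 1 < L) (hβ : 0 < β) : 0 < L ^ (-β) ∧ L ^ (-β) < 1 :=
  rpow_neg_pos_lt_one hL hβ

/-- The letter is ANTITONE in the exponent: `β ≤ β′ ⇒ L^{−β′} ≤ L^{−β}` (`1 ≤ L`). [folklore] -/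
theorem rate_antitone {L β β' : ℝ} (hL : 1 ≤ L) (h : β ≤ β') : L ^ (-β') ≤ L ^ (-β) :=
  Real.rpow_le_rpow_of_exponent_le hL (by linarith)

/-- The gap `1 − L^{−β}` is INCREASING in β: on a declared range `β₁ ≤ β ≤ β₀` the binding case is the LOWER end `β₁`. [folklore] -/
theorem gap_mono {L β β' : ℝ} (hL : 1 ≤ L) (h : β ≤ β') : 1 - L ^ (-β) ≤ 1 - L ^ (-β') := by
  have := rate_antitone hL h
  linarith

/-- `β = 1` is the former letter: `L^{−1} = 1/L` (owner's `rpow_neg_one_eq_inv`). [folklore] -/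
theorem rate_at_one {L : ℝ} (hL : 0 < L) : L ^ (-(1:ℝ)) = 1 / L := by
  rw [rpow_neg_one_eq_inv hL, one_div]

/-- `β = 0`: the letter is `1` (no decay per creation step). [folklore] -/
theorem rate_at_zero (L : ℝ) : L ^ (-(0:ℝ)) = 1 := by
  rw [neg_zero, Real.rpow_zero]

/-- **THE GAP CLOSES LINEARLY AS β ↓ 0**: `1 − L^{−β} ≤ β·log L` for `0 < L` (`e^{x} ≥ 1 + x` at `x = −β·log L`). [folklore] -/
theorem one_sub_rate_le {L : ℝ} (hL : 0 < L) (β : ℝ) : 1 - L ^ (-β) ≤ β * Real.log L := by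
  have h := Real.add_one_le_exp (-(β * Real.log L))
  have hdef : L ^ (-β) = Real.exp (Real.log L * (-β)) := Real.rpow_def_of_pos hL _
  rw [hdef, show Real.log L * (-β) = -(β * Real.log L) by ring]
  linarith

end Letter

/-! ## §2 The threshold at the amended letter -/

section Threshold

/-- The threshold in `M` at ANY rate letter: `ω + X/M⁴ < 1 ↔ X < (1 − ω)·M⁴` (`M > 0`; (w6)'s `gap_threshold_iff` is `ω = 1/L`).
[folklore] -/
theorem gap_threshold_iff_rate {ω M X : ℝ} (hM : 0 < M) : ω + X / M ^ 4 < 1 ↔ X < (1 - ω) * M ^ 4 := by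
  rw [← div_lt_iff₀ (by positivity : (0 : ℝ) < M ^ 4)]
  constructor <;> intro h <;> linarith

/-- **FADING FROM THE PRINTED STANDING ASSUMPTIONS AT ANY RATE LETTER ω, modulo ONE clause of the printed TYPE «M sufficiently
large».**  With `lipbar = c₁·α₄/E₀` (TYPE (2.18) × (1.36) × (2.20)), `τ̄ = c₂·(6L)⁴` (TYPE [II] p. 8, the per-step constant `c_Q` of
the owner's `tauOfG`), the new-term budget `B`, and the located standing assumptions typed as hypotheses — `(L·M)⁴·α₄ ≤ 1` (p. 20)
and `B ≤ E₀/2` (p. 21) — the clause `648·K·c₁c₂ < (1 − ω)·M⁴` gives `ω + K·lipbar·B·τ̄ < 1` ((w6) `rateGap_le_of_printed` BY NAME: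
`E₀` cancels, no `ε₁` survives).  Hypothesis shapes only; nothing of [I]/[II] asserted.
[cite: Balaban1988RG2Cluster, p.8, (1.36) p.9, (2.18)-(2.20) p.16, p.20, (2.41) p.21; Balaban1987RG1, Thm 3 p.264] -/
theorem fade_of_printed_rate {ω K L M α₄ E₀ B c₁ c₂ : ℝ} (hK : 0 ≤ K) (hM : 0 < M) (hE : 0 < E₀) (hB : 0 ≤ B)
    (hc₁ : 0 ≤ c₁) (hc₂ : 0 ≤ c₂) (h20 : (L * M) ^ 4 * α₄ ≤ 1) (h21 : B ≤ E₀ / 2)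
    (hroom : 648 * K * (c₁ * c₂) < (1 - ω) * M ^ 4) :
    ω + K * (c₁ * α₄ / E₀) * B * (c₂ * (6 * L) ^ 4) < 1 := by
  have h := rateGap_le_of_printed hK hM hE hB hc₁ hc₂ h20 h21
  have h' : ω + 648 * K * (c₁ * c₂) / M ^ 4 < 1 := (gap_threshold_iff_rate hM).mpr hroom
  linarith

/-- **THE AMENDED (w6) THRESHOLD: FADING AT `ω = L^{−β}`, β DECLARED.**  `fade_of_printed_rate` at `ω := L^{−β}`: under the two
located standing assumptions and the ONE clause `648·K·c₁c₂ < (1 − L^{−β})·M⁴`, the rate `L^{−β} + K·lipbar·B·τ̄` is `< 1`.  The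
exponent `β` is a DECLARED letter (TYPE [I] (4.18) p. 285 «0 ≦ β ≦ β₀ < 1» with p. 288 «a positive β»); the clause is the printed
TYPE «M sufficiently large» ([I] Thm 3 p. 264 «M ≥ M(κ)», [II] p. 21), now `M = M(β)` (§2 `room_not_uniform`).  Hypothesis shapes
only. [cite: Balaban1987RG1, (4.18) p.285, p.288, (0.30) p.258, Thm 3 p.264; Balaban1988RG2Cluster, p.20, p.21] -/
theorem fade_of_printed_rpow {K L M α₄ E₀ B c₁ c₂ β : ℝ} (hK : 0 ≤ K) (hM : 0 < M) (hE : 0 < E₀) (hB : 0 ≤ B)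
    (hc₁ : 0 ≤ c₁) (hc₂ : 0 ≤ c₂) (h20 : (L * M) ^ 4 * α₄ ≤ 1) (h21 : B ≤ E₀ / 2)
    (hroom : 648 * K * (c₁ * c₂) < (1 - L ^ (-β)) * M ^ 4) :
    L ^ (-β) + K * (c₁ * α₄ / E₀) * B * (c₂ * (6 * L) ^ 4) < 1 :=
  fade_of_printed_rate hK hM hE hB hc₁ hc₂ h20 h21 hroom

/-- **UNIFORM FORM ON A DECLARED RANGE `β₁ ≤ β`** (`1 ≤ L`): the room at the lower end `β₁` suffices for every larger exponent
(`gap_mono`). [cite: Balaban1987RG1, (4.18) p.285, p.288] -/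
theorem fade_of_printed_rpow_of_le {K L M α₄ E₀ B c₁ c₂ β β₁ : ℝ} (hL : 1 ≤ L) (hβ : β₁ ≤ β) (hK : 0 ≤ K) (hM : 0 < M)
    (hE : 0 < E₀) (hB : 0 ≤ B) (hc₁ : 0 ≤ c₁) (hc₂ : 0 ≤ c₂) (h20 : (L * M) ^ 4 * α₄ ≤ 1) (h21 : B ≤ E₀ / 2)
    (hroom : 648 * K * (c₁ * c₂) < (1 - L ^ (-β₁)) * M ^ 4) :
    L ^ (-β) + K * (c₁ * α₄ / E₀) * B * (c₂ * (6 * L) ^ 4) < 1 :=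
  fade_of_printed_rpow hK hM hE hB hc₁ hc₂ h20 h21
    (hroom.trans_le (mul_le_mul_of_nonneg_right (gap_mono hL hβ) (by positivity)))

/-- **(w6) IS THE INSTANCE β = 1**: `NE9FadingArithmetic.fade_of_printed` restated with the letter `L^{−1}` (`rate_at_one`).
[cite: Balaban1988RG2Cluster, p.20, p.21] -/
theorem fade_of_printed_rpow_one {K L M α₄ E₀ B c₁ c₂ : ℝ} (hL : 0 < L) (hK : 0 ≤ K) (hM : 0 < M) (hE : 0 < E₀)
    (hB : 0 ≤ B) (hc₁ : 0 ≤ c₁) (hc₂ : 0 ≤ c₂) (h20 : (L * M) ^ 4 * α₄ ≤ 1) (h21 : B ≤ E₀ / 2)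
    (hroom : 648 * K * (c₁ * c₂) < (1 - 1 / L) * M ^ 4) :
    L ^ (-(1:ℝ)) + K * (c₁ * α₄ / E₀) * B * (c₂ * (6 * L) ^ 4) < 1 := by
  rw [rate_at_one hL]
  exact fade_of_printed hK hM hE hB hc₁ hc₂ h20 h21 hroom

/-- **NECESSITY OF A POSITIVE EXPONENT**: at `β = 0` (admitted by (4.18)'s «0 ≦ β») the letter is `1` and NO nonnegative gap
`K·l·B·t` fades — N2 at the amended letter needs p. 288's «positive β» STRICTLY (our inequality's tightness, not a printed claim).
[cite: Balaban1987RG1, (4.18) p.285, p.288] -/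
theorem not_fade_at_exponent_zero {K L l B t : ℝ} (hK : 0 ≤ K) (hl : 0 ≤ l) (hB : 0 ≤ B) (ht : 0 ≤ t) :
    ¬ (L ^ (-(0:ℝ)) + K * l * B * t < 1) := by
  rw [rate_at_zero]
  have : 0 ≤ K * l * B * t := by positivity
  intro h
  linarith

/-- The room of the clause is at most `β·log L·M⁴`: `(1 − L^{−β})·M⁴ ≤ β·log L·M⁴`. [folklore] -/
theorem room_le {L M : ℝ} (hL : 0 < L) (β : ℝ) : (1 - L ^ (-β)) * M ^ 4 ≤ β * Real.log L * M ^ 4 :=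
  mul_le_mul_of_nonneg_right (one_sub_rate_le hL β) (by positivity)

/-- **«M SUFFICIENTLY LARGE» IS `M = M(β)`, NOT UNIFORM IN β**: for `1 < L`, `0 < M` and ANY positive budget `X` (e.g.
`648·K·c₁c₂ > 0`) there is a POSITIVE exponent β at which the clause `X < (1 − L^{−β})·M⁴` FAILS — explicitly
`β = X/(2·log L·M⁴)`.  So a threshold «for all β ∈ ]0, β₀]» does not exist; the declared β (or a declared lower bound β₁) is a
genuine input of N2. [cite: Balaban1987RG1, (4.18) p.285, p.288, Thm 3 p.264] -/
theorem room_not_uniform {L M X : ℝ} (hL : 1 < L) (hM : 0 < M) (hX : 0 < X) :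
    ∃ β : ℝ, 0 < β ∧ (1 - L ^ (-β)) * M ^ 4 < X := by
  have hlog : 0 < Real.log L := Real.log_pos hL
  have hM4 : 0 < M ^ 4 := by positivity
  refine ⟨X / (2 * Real.log L * M ^ 4), by positivity, ?_⟩
  calc (1 - L ^ (-(X / (2 * Real.log L * M ^ 4)))) * M ^ 4
      ≤ X / (2 * Real.log L * M ^ 4) * Real.log L * M ^ 4 := room_le (by linarith) _
    _ = X / 2 := by field_simp
    _ < X := by linarith

/-- (w10)-COMPATIBILITY: every lemma is parametric in `K ≥ 0`, so the marginal-projection rider `K_eff = K·(1 + c)`, `c = cr·aA ≥ 0`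
(`NE9FadingArithmeticRider.rate_marg_eq`) is an instance of `fade_of_printed_rpow`. [folklore] -/
example {K L M α₄ E₀ B c₁ c₂ β c : ℝ} (hK : 0 ≤ K) (hc : 0 ≤ c) (hM : 0 < M) (hE : 0 < E₀) (hB : 0 ≤ B) (hc₁ : 0 ≤ c₁)
    (hc₂ : 0 ≤ c₂) (h20 : (L * M) ^ 4 * α₄ ≤ 1) (h21 : B ≤ E₀ / 2)
    (hroom : 648 * (K * (1 + c)) * (c₁ * c₂) < (1 - L ^ (-β)) * M ^ 4) :
    L ^ (-β) + K * (1 + c) * (c₁ * α₄ / E₀) * B * (c₂ * (6 * L) ^ 4) < 1 :=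
  fade_of_printed_rpow (mul_nonneg hK (by linarith)) hM hE hB hc₁ hc₂ h20 h21 hroom

end Threshold

/-! ## §3 The j-summed companion of the channel weight at the amended letter -/

section Companion

/-- **PRINT's j-SUMMED CONSTANT AT `ω = L^{−β}`**: `Σ_{j≤k} c_Q·(L^{−β})^{k−j} ≤ c_Q·(1 − L^{−β})⁻¹` — the owner's
`NE9Lemma1Gain.sum_tauOfG_le` at the amended letter (TYPE [I] (0.30) «≦ O(1)(1 − L^{−α})⁻¹»; at β = 1 and L = 13 this is (w6)'s
«sum over j bounded by 2(6L)⁴»-type constant `(1 − 1/13)⁻¹ = 13/12 ≤ 2`). [cite: Balaban1987RG1, (0.30) p.258] -/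
theorem sum_companion_le {cQ L β : ℝ} (hcQ : 0 ≤ cQ) (hL : 1 < L) (hβ : 0 < β) (k : ℕ) :
    ∑ j ∈ Finset.range (k + 1), tauOfG cQ (agePow (L ^ (-β))) k j ≤ cQ * (1 - L ^ (-β))⁻¹ :=
  sum_tauOfG_le hcQ (rate_pos_lt_one hL hβ).1.le (rate_pos_lt_one hL hβ).2 k

/-- The companion constant `(1 − L^{−β})⁻¹` is ANTITONE in β: on a declared range `β₁ ≤ β` it is at most its value at `β₁`
(`1 < L`, `0 < β₁`). [folklore] -/
theorem companion_le_of_le {L β β₁ : ℝ} (hL : 1 < L) (hβ₁ : 0 < β₁) (h : β₁ ≤ β) :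
    (1 - L ^ (-β))⁻¹ ≤ (1 - L ^ (-β₁))⁻¹ := by
  have h1 : 0 < 1 - L ^ (-β₁) := by linarith [(rate_pos_lt_one hL hβ₁).2]
  exact inv_anti₀ h1 (gap_mono hL.le h)

end Companion

/-! ## §4 Numeric corners (no letter of Bałaban's is valued; two external engines reproduce the table, census sheet v1.3 §9) -/

section Numerics

/-- `(13^{−1/4})⁴ = 1/13`. [folklore] -/
theorem rpow13_neg_quarter_pow_four : ((13:ℝ) ^ (-(1/4:ℝ))) ^ 4 = 1 / 13 := by
  rw [← Real.rpow_natCast, ← Real.rpow_mul (by norm_num : (0:ℝ) ≤ 13)]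
  norm_num

/-- **`10/19 < 13^{−1/4} < 100/189`** — from `(10/19)⁴ = 10⁴/130321 < 1/13 < 10⁸/1275989841 = (100/189)⁴`. [folklore] -/
theorem rpow13_neg_quarter_bounds :
    (10:ℝ) / 19 < (13:ℝ) ^ (-(1/4:ℝ)) ∧ (13:ℝ) ^ (-(1/4:ℝ)) < 100 / 189 := by
  have hx : 0 < (13:ℝ) ^ (-(1/4:ℝ)) := Real.rpow_pos_of_pos (by norm_num) _
  have h4 := rpow13_neg_quarter_pow_four
  constructor
  · by_contra h
    push Not at h
    have h' : ((13:ℝ) ^ (-(1/4:ℝ))) ^ 4 ≤ ((10:ℝ) / 19) ^ 4 := pow_le_pow_left₀ hx.le h 4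
    rw [h4] at h'
    norm_num at h'
  · by_contra h
    push Not at h
    have h' : ((100:ℝ) / 189) ^ 4 ≤ ((13:ℝ) ^ (-(1/4:ℝ))) ^ 4 := pow_le_pow_left₀ (by norm_num) h 4
    rw [h4] at h'
    norm_num at h'

/-- At the least printed side length `L = 13` ([I] p. 251 «L … > 11»), `M = L`, `K = 4` and the declared exponent `β = 1/4`: the
clause of `fade_of_printed_rpow` HOLDS whenever `c₁c₂ ≤ 2541929/489888` (≈ 5.19) — versus (w6)'s room `6591/648 ≈ 10.17` at β = 1.
[folklore] -/
theorem room_quarter_suff {c : ℝ} (hc : c ≤ 2541929 / 489888) :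
    648 * 4 * c < (1 - (13:ℝ) ^ (-(1/4:ℝ))) * 13 ^ 4 := by
  have h := rpow13_neg_quarter_bounds.2
  nlinarith [h, hc]

/-- … and FAILS whenever `c₁c₂ ≥ 257049/49248` (≈ 5.22): the room at β = 1/4 lies in `]5.18, 5.22[`. [folklore] -/
theorem room_quarter_nec {c : ℝ} (hc : 257049 / 49248 ≤ c) :
    ¬ (648 * 4 * c < (1 - (13:ℝ) ^ (-(1/4:ℝ))) * 13 ^ 4) := by
  have h := rpow13_neg_quarter_bounds.1
  intro h'
  nlinarith [h, hc, h']

/-- K = 8 (vacuum-subtracted faces) halves the room: sufficient whenever `c₁c₂ ≤ 2541929/979776` (≈ 2.59). [folklore] -/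
theorem room_quarter_suff_eight {c : ℝ} (hc : c ≤ 2541929 / 979776) :
    648 * 8 * c < (1 - (13:ℝ) ^ (-(1/4:ℝ))) * 13 ^ 4 := by
  have h := rpow13_neg_quarter_bounds.2
  nlinarith [h, hc]

/-- The analytic ceiling of the room: at `L = M = 13`, `K = 4` the clause forces `c₁c₂ < β·log 13·28561/2592` — e.g. `< 0.29·β·…`;
numerically `log 13 < 2.57` is not valued in the kernel; the exact statement is `room_le`. Toy instance of `room_not_uniform` at
`X = 648·4·c₁c₂`: [folklore] -/
example {c : ℝ} (hc : 0 < c) : ∃ β : ℝ, 0 < β ∧ (1 - (13:ℝ) ^ (-β)) * 13 ^ 4 < 648 * 4 * c :=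
  room_not_uniform (by norm_num) (by norm_num) (by positivity)

end Numerics

end Summit.QuantumFields.BalabanUV.T4Continuum.NE9FadingArithmeticHolder
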